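import Literature.Geometry.Kaehler.MayerVietoris
import Literature.Geometry.Kaehler.ChartTransport
import Literature.AlgebraicTopology.SingularHomology.LocalHomology
import HarnessLib

/-!
# The de Rham complex of an open subset as a cochain complex; Mayer–Vietoris; Poincaré lemma

De Rham side of the integration proof of **de Rham's theorem** (Bredon, *Topology and Geometry*
(1993), §V.9; Bott–Tu (1982), §I.2, Prop. 2.3; Lee (2013), Thm. 17.20, Thm. 18.14).

The tree realises the forms on an open `U ⊆ M` inside `MForm I M F k` (`smoothFormsOn I F U k`,
`localD`, `LocalDeRham`; `Literature.Geometry.Kaehler.LocalForms`). Here we package them as an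
honest cochain complex of `ℝ`-modules **of the same shape `(ComplexShape.down ℕ).symm` and in the
same category `ModuleCat ℝ` as the tree's singular cochain complexes of subsets**
(`…SingularHomology.subsetCochains`), so that the comparison map "integration over smooth
simplices" can be a morphism of complexes and the Mayer–Vietoris ladders can be fed to the
five lemma (`Literature.Algebra.Homology.isIso_homologyMap_τ₁_of_forall`):

* `localDeRhamComplex I F hU = Ω•(U)` (`X k = smoothFormsOn I F U k`, `d = localD`), its
  restriction maps `res` (functorial), the cocycle / coboundary criteria in terms of
  `localClosedForms` / `localExactForms`;
* `mvShortComplex`: `0 → Ω•(A ∪ B) → Ω•(A) ⊞ Ω•(B) → Ω•(A ∩ B) → 0`, `ω ↦ (ω|, ω|)`,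
  `(α, β) ↦ α| - β|`, and `mvShortComplex_shortExact` (injective: a form on `A ∪ B` is determined
  by its restrictions; exact: gluing, `glue_mem_smoothFormsOn`; surjective: bump pairs,
  `BumpPair.leftPiece / rightPiece`) — Bott–Tu (1982), Prop. 2.3;
* `isZero_homology_chartSet`: **Poincaré lemma** — `Hᵠ(Ω•(U)) = 0` for `q ≥ 1` on a chart-convex
  set `U = chartSet I p C` (the tree's `localClosedForms_chartSet_le_localExactForms`), and
  `apply_eq_of_d_eq_zero_chartSet`: closed `0`-forms there are constant.

## References

* R. Bott, L. W. Tu, *Differential Forms in Algebraic Topology* (1982), §I.2, Prop. 2.3.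
* G. E. Bredon, *Topology and Geometry* (1993), §V.9.
* J. M. Lee, *Introduction to Smooth Manifolds*, 2nd ed. (2013), Thm. 17.14, Thm. 17.20.
-/

noncomputable section

-- as in `…SingularHomology.SingularChainsConcrete` / `ChainSubcomplex`: the identification of the
-- chain modules `(localDeRhamComplex I F hU).X k` with `ModuleCat.of ℝ (smoothFormsOn I F U k)` is
-- used up to unfolding of the (semireducible) definition
set_option backward.isDefEq.respectTransparency false

open scoped Manifold ContDiff Topology
open CategoryTheory Limits Set Filter
open Literature.AlgebraicTopology.SingularHomology (biprod_decomp isZero_homology_iff exists_d_prev_eq_iff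
  d_next_eq_zero_iff)

universe u v w

namespace Literature.Geometry.Kaehler

variable {E : Type u} [NormedAddCommGroup E] [NormedSpace ℝ E]
  {H : Type*} [TopologicalSpace H] (I : ModelWithCorners ℝ E H)
  {M : Type u} [TopologicalSpace M] [ChartedSpace H M]
  (F : Type v) [NormedAddCommGroup F] [NormedSpace ℝ F]

/-! ### The complex -/

section Complex

variable [IsManifold I ∞ M]

/-- **The de Rham complex `Ω•(U)` of an open subset `U ⊆ M`** as a cochain complex of real vector
spaces of shape `(ComplexShape.down ℕ).symm` (degree raising): `Ωᵏ(U) = smoothFormsOn I F U k`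
(forms smooth on `U`, zero off `U`), `d = localD` (Bott–Tu (1982), §I.1–I.2; Bredon (1993), §V.9,
the functor `U ↦ Ω*(U)`). [cite: BottTu1982Forms, §I.2] -/
def localDeRhamComplex {U : Set M} (hU : IsOpen U) :
    HomologicalComplex (ModuleCat.{max u v} ℝ) (ComplexShape.down ℕ).symm where
  X k := ModuleCat.of ℝ (smoothFormsOn I F U k)
  d i j := if h : i + 1 = j then ModuleCat.ofHom (localD I F i hU) ≫ eqToHom (by rw [h]) else 0
  shape i j h := dif_neg h
  d_comp_d' i j l hij hjl := by
    change i + 1 = j at hij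
    change j + 1 = l at hjl
    subst hij hjl
    simp only [dif_pos, eqToHom_refl, Category.comp_id]
    ext x
    simp [localD_localD]

variable {I F}

/-- The differential of `Ω•(U)` in consecutive degrees is `localD` (as a morphism). [folklore] -/
theorem localDeRhamComplex_d {U : Set M} (hU : IsOpen U) (i : ℕ) :
    (localDeRhamComplex I F hU).d i (i + 1) = ModuleCat.ofHom (localD I F i hU) := by
  dsimp only [localDeRhamComplex]
  rw [dif_pos rfl, eqToHom_refl, Category.comp_id]

/-- The differential of `Ω•(U)` in consecutive degrees is `localD`. [folklore] -/
@[simp]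
theorem localDeRhamComplex_d_apply {U : Set M} (hU : IsOpen U) (i : ℕ) (x : smoothFormsOn I F U i) :
    (localDeRhamComplex I F hU).d i (i + 1) x = localD I F i hU x := by
  rw [localDeRhamComplex_d]
  rfl

/-- `next i = i + 1` for the cohomological shape. [folklore] -/
theorem cnext (i : ℕ) : (ComplexShape.down ℕ).symm.next i = i + 1 :=
  (ComplexShape.down ℕ).symm.next_eq' rfl

/-- `prev (i + 1) = i` for the cohomological shape. [folklore] -/
theorem cprev (i : ℕ) : (ComplexShape.down ℕ).symm.prev (i + 1) = i :=
  (ComplexShape.down ℕ).symm.prev_eq' rfl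

/-- `prev 0 = 0` for the cohomological shape (no predecessor). [folklore] -/
theorem cprev_zero : (ComplexShape.down ℕ).symm.prev 0 = 0 := by
  rw [ComplexShape.prev]
  rw [dif_neg]
  rintro ⟨i, hi⟩
  change i + 1 = 0 at hi
  omega

/-- **Cocycles of `Ω•(U)` are the closed forms on `U`.** [cite: BottTu1982Forms, §I.1] -/
theorem localDeRhamComplex_d_eq_zero_iff {U : Set M} (hU : IsOpen U) (i : ℕ)
    (x : smoothFormsOn I F U i) :
    (localDeRhamComplex I F hU).d i (i + 1) x = 0 ↔ (x : MForm I M F i) ∈ localClosedForms I F i U := by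
  rw [localDeRhamComplex_d_apply, mem_localClosedForms_iff_localD_eq_zero hU]

/-- **Coboundaries of `Ω•(U)` are the exact forms on `U`** (positive degree). [cite: BottTu1982Forms, §I.1] -/
theorem localDeRhamComplex_exists_d_eq_iff {U : Set M} (hU : IsOpen U) (i : ℕ)
    (x : (localDeRhamComplex I F hU).X (i + 1)) :
    (∃ w : (localDeRhamComplex I F hU).X i, (localDeRhamComplex I F hU).d i (i + 1) w = x) ↔
      (x.1 : MForm I M F (i + 1)) ∈ localExactForms I F hU (i + 1) := by
  rw [mem_localExactForms_succ_iff hU]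
  constructor
  · rintro ⟨w, hw⟩
    refine ⟨w, ?_⟩
    rw [localDeRhamComplex_d_apply] at hw
    exact congrArg Subtype.val hw
  · rintro ⟨w, hw⟩
    refine ⟨w, ?_⟩
    rw [localDeRhamComplex_d_apply]
    exact Subtype.ext hw

/-! ### Restriction -/

variable (I F)

/-- **Restriction `Ω•(V) ⟶ Ω•(U)` for open `U ⊆ V`** (a morphism of complexes: `d` is local,
`localD_restrictₗ`). Bott–Tu (1982), §I.2. [cite: BottTu1982Forms, §I.2] -/
def localDeRhamComplex.res {U V : Set M} (hU : IsOpen U) (hV : IsOpen V) (hUV : U ⊆ V) :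
    localDeRhamComplex I F hV ⟶ localDeRhamComplex I F hU where
  f k := ModuleCat.ofHom (restrictₗ I F k hU hUV)
  comm' i j hij := by
    change i + 1 = j at hij
    subst hij
    rw [localDeRhamComplex_d, localDeRhamComplex_d]
    ext x
    exact localD_restrictₗ hU hV hUV x

variable {I F}

/-- Restriction acts on elements by `restrictₗ`. [folklore] -/
@[simp]
theorem localDeRhamComplex.res_f_apply {U V : Set M} (hU : IsOpen U) (hV : IsOpen V) (hUV : U ⊆ V)
    (k : ℕ) (x : smoothFormsOn I F V k) :
    (localDeRhamComplex.res I F hU hV hUV).f k x = restrictₗ I F k hU hUV x :=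
  rfl

/-- Restriction along `U ⊆ U` is the identity. [folklore] -/
@[simp]
theorem localDeRhamComplex.res_refl {U : Set M} (hU : IsOpen U) :
    localDeRhamComplex.res I F hU hU subset_rfl = 𝟙 _ := by
  ext k x
  change restrictₗ I F k hU subset_rfl x = x
  exact Subtype.ext (restr_eq_self_of_mem x.2)

/-- **Restrictions compose.** [cite: BottTu1982Forms, §I.2] -/
@[reassoc]
theorem localDeRhamComplex.res_comp {U V W : Set M} (hU : IsOpen U) (hV : IsOpen V) (hW : IsOpen W)
    (hUV : U ⊆ V) (hVW : V ⊆ W) :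
    localDeRhamComplex.res I F hV hW hVW ≫ localDeRhamComplex.res I F hU hV hUV =
      localDeRhamComplex.res I F hU hW (hUV.trans hVW) := by
  ext k x
  change restrictₗ I F k hU hUV (restrictₗ I F k hV hVW x) = restrictₗ I F k hU (hUV.trans hVW) x
  exact Subtype.ext (MForm.restr_restr_of_subset hUV _)

/-- Restriction does not depend on the proof of inclusion. [folklore] -/
theorem localDeRhamComplex.res_congr {U V : Set M} (hU : IsOpen U) (hV : IsOpen V) (h h' : U ⊆ V) :
    localDeRhamComplex.res I F hU hV h = localDeRhamComplex.res I F hU hV h' := rfl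

end Complex

/-! ### The Mayer–Vietoris short exact sequence of de Rham complexes -/

section MayerVietoris

variable [IsManifold I ∞ M] {A B : Set M} (hA : IsOpen A) (hB : IsOpen B)

/-- Local notation for the de Rham complexes of the four sets. -/
local notation "Ω∪" => localDeRhamComplex I F (hA.union hB)
local notation "ΩA" => localDeRhamComplex I F hA
local notation "ΩB" => localDeRhamComplex I F hB
local notation "Ω∩" => localDeRhamComplex I F (hA.inter hB)

/-- **The Mayer–Vietoris short complex of de Rham complexes**
`Ω•(A ∪ B) → Ω•(A) ⊞ Ω•(B) → Ω•(A ∩ B)`, `ω ↦ (ω|_A, ω|_B)`, `(α, β) ↦ α|_{A∩B} - β|_{A∩B}`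
(Bott–Tu (1982), §I.2, (2.2)–(2.4); signs as in the tree's `subsetCochains.mvShortComplex`). [cite: BottTu1982Forms, Prop. 2.3] -/
abbrev localDeRhamComplex.mvShortComplex :
    ShortComplex (HomologicalComplex (ModuleCat.{max u v} ℝ) (ComplexShape.down ℕ).symm) where
  X₁ := Ω∪
  X₂ := ΩA ⊞ ΩB
  X₃ := Ω∩
  f := biprod.lift (localDeRhamComplex.res I F hA (hA.union hB) subset_union_left)
    (localDeRhamComplex.res I F hB (hA.union hB) subset_union_right)
  g := biprod.desc (localDeRhamComplex.res I F (hA.inter hB) hA inter_subset_left)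
    (-localDeRhamComplex.res I F (hA.inter hB) hB inter_subset_right)
  zero := by
    rw [biprod.lift_desc, Preadditive.comp_neg, localDeRhamComplex.res_comp,
      localDeRhamComplex.res_comp]
    exact add_neg_eq_zero.mpr rfl

variable {I F hA hB}

section BiprodApply

variable {R : Type*} [Ring R] {ι : Type*} {c : ComplexShape ι}

/-- Components of `(biprod.lift a b) x`. [folklore] -/
theorem lift_f_apply {K L N : HomologicalComplex (ModuleCat.{w} R) c}
    (a : K ⟶ L) (b : K ⟶ N) (i : ι) (x : K.X i) :
    (biprod.lift a b).f i x = (biprod.inl : _ ⟶ L ⊞ N).f i (a.f i x) +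
      (biprod.inr : _ ⟶ L ⊞ N).f i (b.f i x) := by
  rw [biprod.lift_eq, HomologicalComplex.add_f_apply, HomologicalComplex.comp_f,
    HomologicalComplex.comp_f]
  rfl

/-- `fst (lift a b x) = a x`. [folklore] -/
theorem fst_lift_f_apply {K L N : HomologicalComplex (ModuleCat.{w} R) c}
    (a : K ⟶ L) (b : K ⟶ N) (i : ι) (x : K.X i) :
    (biprod.fst : L ⊞ N ⟶ L).f i ((biprod.lift a b).f i x) = a.f i x := by
  rw [← ModuleCat.comp_apply, ← HomologicalComplex.comp_f, biprod.lift_fst]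

/-- `snd (lift a b x) = b x`. [folklore] -/
theorem snd_lift_f_apply {K L N : HomologicalComplex (ModuleCat.{w} R) c}
    (a : K ⟶ L) (b : K ⟶ N) (i : ι) (x : K.X i) :
    (biprod.snd : L ⊞ N ⟶ N).f i ((biprod.lift a b).f i x) = b.f i x := by
  rw [← ModuleCat.comp_apply, ← HomologicalComplex.comp_f, biprod.lift_snd]

/-- `desc a b (inl y) = a y`. [folklore] -/
theorem desc_f_inl_apply {K L N : HomologicalComplex (ModuleCat.{w} R) c}
    (a : L ⟶ K) (b : N ⟶ K) (i : ι) (y : L.X i) :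
    (biprod.desc a b).f i ((biprod.inl : _ ⟶ L ⊞ N).f i y) = a.f i y := by
  rw [← ModuleCat.comp_apply, ← HomologicalComplex.comp_f, biprod.inl_desc]

/-- `desc a b (inr z) = b z`. [folklore] -/
theorem desc_f_inr_apply {K L N : HomologicalComplex (ModuleCat.{w} R) c}
    (a : L ⟶ K) (b : N ⟶ K) (i : ι) (z : N.X i) :
    (biprod.desc a b).f i ((biprod.inr : _ ⟶ L ⊞ N).f i z) = b.f i z := by
  rw [← ModuleCat.comp_apply, ← HomologicalComplex.comp_f, biprod.inr_desc]

/-- `(-φ) x = -(φ x)` degreewise, for morphisms of complexes of modules. [folklore] -/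
theorem neg_f_apply' {K L : HomologicalComplex (ModuleCat.{w} R) c} (φ : K ⟶ L) (i : ι) (x : K.X i) :
    (-φ).f i x = -(φ.f i x) := by
  rw [HomologicalComplex.neg_f_apply]
  rfl

end BiprodApply

/-- `ω ↦ (ω|_A, ω|_B)` is injective: a form on `A ∪ B` is determined by its restrictions
(Bott–Tu (1982), Prop. 2.3, exactness on the left). [cite: BottTu1982Forms, Prop. 2.3] -/
theorem mvShortComplex_f_injective (i : ℕ) :
    Function.Injective ((localDeRhamComplex.mvShortComplex I F hA hB).f.f i) := by
  intro x y hxy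
  dsimp only [localDeRhamComplex.mvShortComplex] at hxy
  have h1 := congrArg ((biprod.fst : ΩA ⊞ ΩB ⟶ ΩA).f i) hxy
  have h2 := congrArg ((biprod.snd : ΩA ⊞ ΩB ⟶ ΩB).f i) hxy
  rw [fst_lift_f_apply, fst_lift_f_apply, localDeRhamComplex.res_f_apply,
    localDeRhamComplex.res_f_apply] at h1
  rw [snd_lift_f_apply, snd_lift_f_apply, localDeRhamComplex.res_f_apply,
    localDeRhamComplex.res_f_apply] at h2
  have h1' : ((x.1 : MForm I M F i) - y.1).restr A = 0 := by
    rw [MForm.restr_sub, sub_eq_zero]; exact congrArg Subtype.val h1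
  have h2' : ((x.1 : MForm I M F i) - y.1).restr B = 0 := by
    rw [MForm.restr_sub, sub_eq_zero]; exact congrArg Subtype.val h2
  have h := eq_zero_of_restr_eq_zero (sub_mem x.2 y.2) h1' h2'
  exact Subtype.ext (sub_eq_zero.1 h)

/-- `(α, β) ↦ α| - β|` is surjective: every form on `A ∩ B` is a difference of restrictions, by
a bump pair (Bott–Tu (1982), Prop. 2.3, exactness on the right: `ω = (ρ_B ω) - (-ρ_A ω)`).
[cite: BottTu1982Forms, Prop. 2.3] -/
theorem mvShortComplex_g_surjective (b : BumpPair I A B) (i : ℕ) :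
    Function.Surjective ((localDeRhamComplex.mvShortComplex I F hA hB).g.f i) := by
  intro γ
  set u : smoothFormsOn I F A i := ⟨b.leftPiece (γ.1 : MForm I M F i), b.leftPiece_mem hA γ.2⟩ with hu
  set v : smoothFormsOn I F B i := ⟨b.rightPiece (γ.1 : MForm I M F i), b.rightPiece_mem hB γ.2⟩ with hv
  refine ⟨(biprod.inl : _ ⟶ ΩA ⊞ ΩB).f i u + (biprod.inr : _ ⟶ ΩA ⊞ ΩB).f i v, ?_⟩
  dsimp only [localDeRhamComplex.mvShortComplex]
  rw [map_add, desc_f_inl_apply, desc_f_inr_apply, neg_f_apply',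
    localDeRhamComplex.res_f_apply, localDeRhamComplex.res_f_apply]
  refine Subtype.ext (funext fun x ↦ ?_)
  change ((u : MForm I M F i).restr (A ∩ B) + -((v : MForm I M F i).restr (A ∩ B))) x = (γ.1 : MForm I M F i) x
  by_cases hx : x ∈ A ∩ B
  · rw [Pi.add_apply, Pi.neg_apply, MForm.restr_apply_of_mem _ hx, MForm.restr_apply_of_mem _ hx,
      ← sub_eq_add_neg]
    exact b.leftPiece_sub_rightPiece_apply _ hx
  · rw [Pi.add_apply, Pi.neg_apply, MForm.restr_apply_of_notMem _ hx, MForm.restr_apply_of_notMem _ hx,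
      neg_zero, add_zero, γ.2.2 x hx]

/-- Exactness in the middle: a pair of forms with equal restrictions to `A ∩ B` glues to a
form on `A ∪ B` (Bott–Tu (1982), Prop. 2.3; the tree's `glue_mem_smoothFormsOn`). [cite: BottTu1982Forms, Prop. 2.3] -/
theorem mvShortComplex_exact_aux (i : ℕ) :
    Function.Exact ((localDeRhamComplex.mvShortComplex I F hA hB).f.f i)
      ((localDeRhamComplex.mvShortComplex I F hA hB).g.f i) := by
  intro y
  constructor
  · intro hy
    set a : smoothFormsOn I F A i := (biprod.fst : ΩA ⊞ ΩB ⟶ ΩA).f i y with ha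
    set c : smoothFormsOn I F B i := (biprod.snd : ΩA ⊞ ΩB ⟶ ΩB).f i y with hc
    have htot : (biprod.inl : _ ⟶ ΩA ⊞ ΩB).f i a + (biprod.inr : _ ⟶ ΩA ⊞ ΩB).f i c = y :=
      biprod_decomp i y
    -- `a| = c|` on `A ∩ B`
    have hac : (a : MForm I M F i).restr (A ∩ B) = (c : MForm I M F i).restr (A ∩ B) := by
      dsimp only [localDeRhamComplex.mvShortComplex] at hy
      rw [← htot, map_add, desc_f_inl_apply, desc_f_inr_apply, neg_f_apply',
        localDeRhamComplex.res_f_apply, localDeRhamComplex.res_f_apply, ← sub_eq_add_neg,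
        sub_eq_zero] at hy
      exact congrArg Subtype.val hy
    have hagree : ∀ x ∈ A ∩ B, (a : MForm I M F i) x = (c : MForm I M F i) x := fun x hx ↦ by
      rw [← MForm.restr_apply_of_mem (a : MForm I M F i) hx, hac, MForm.restr_apply_of_mem _ hx]
    refine ⟨⟨MForm.glue A B (a : MForm I M F i) (c : MForm I M F i),
      glue_mem_smoothFormsOn hA hB a.2 c.2 hagree⟩, ?_⟩
    rw [← htot]
    dsimp only [localDeRhamComplex.mvShortComplex]
    rw [lift_f_apply, localDeRhamComplex.res_f_apply, localDeRhamComplex.res_f_apply]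
    congr 2
    · exact Subtype.ext (MForm.restr_glue_left a.2.2 _)
    · exact Subtype.ext (MForm.restr_glue_right hagree c.2.2)
  · rintro ⟨x, rfl⟩
    change ((localDeRhamComplex.mvShortComplex I F hA hB).f ≫
      (localDeRhamComplex.mvShortComplex I F hA hB).g).f i x = 0
    rw [(localDeRhamComplex.mvShortComplex I F hA hB).zero]
    rfl

/-- **The Mayer–Vietoris sequence of de Rham complexes is short exact**, given a bump pair for
`(A, B)` (Bott–Tu (1982), Prop. 2.3; Lee (2013), Thm. 17.20). [cite: BottTu1982Forms, Prop. 2.3] -/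
theorem localDeRhamComplex.mvShortComplex_shortExact_of_bumpPair (b : BumpPair I A B) :
    (localDeRhamComplex.mvShortComplex I F hA hB).ShortExact := by
  refine HomologicalComplex.shortExact_of_degreewise_shortExact _ (fun i => ?_)
  exact ModuleCat.shortComplex_shortExact _ (mvShortComplex_exact_aux i) (mvShortComplex_f_injective i)
    (mvShortComplex_g_surjective b i)

/-- **The Mayer–Vietoris sequence of de Rham complexes is short exact** on a Hausdorff,
second-countable `C^∞` manifold with finite-dimensional model (bump pairs exist: partitions of
unity). Bott–Tu (1982), Prop. 2.3. [cite: BottTu1982Forms, Prop. 2.3] -/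
theorem localDeRhamComplex.mvShortComplex_shortExact [FiniteDimensional ℝ E] [T2Space M]
    [SecondCountableTopology M] : (localDeRhamComplex.mvShortComplex I F hA hB).ShortExact :=
  localDeRhamComplex.mvShortComplex_shortExact_of_bumpPair (exists_bumpPair (I := I) hA hB).some

end MayerVietoris

/-! ### The Poincaré lemma: chart-convex sets -/

section Poincare

variable {I F}
variable [IsManifold I ∞ M] [I.Boundaryless] [FiniteDimensional ℝ E] [CompleteSpace F]

/-- **Poincaré lemma for the de Rham complex of a chart-convex set**: for `C` open and convex in
the target of the chart at `p`, `Hᵠ(Ω•(chartSet I p C)) = 0` for every `q ≥ 1` (the tree's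
`localClosedForms_chartSet_le_localExactForms`; Lee (2013), Thm. 17.14; Bott–Tu (1982),
Cor. 4.1.1). [cite: LeeSmoothManifolds2013, Thm. 17.14] -/
theorem localDeRhamComplex.isZero_homology_chartSet (p : M) {C : Set E} (hC : IsOpen C)
    (hCc : Convex ℝ C) (hCT : C ⊆ (extChartAt I p).target) (q : ℕ) :
    IsZero ((localDeRhamComplex I F (isOpen_chartSet I p hC)).homology (q + 1)) := by
  rw [isZero_homology_iff]
  intro z hz
  rw [d_next_eq_zero_iff (cnext (q + 1)), localDeRhamComplex_d_eq_zero_iff] at hz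
  rw [exists_d_prev_eq_iff (cprev q), localDeRhamComplex_exists_d_eq_iff]
  exact localClosedForms_chartSet_le_localExactForms p hC hCc hCT hz

omit [IsManifold I ∞ M] [I.Boundaryless] [FiniteDimensional ℝ E] [CompleteSpace F] in
/-- A `0`-form takes equal values (on the empty tuple) at equal points — the dependent-type
bookkeeping needed to compare `α x` and `α y` for `x = y`. [folklore] -/
theorem MForm.apply_zero_eq_of_eq (α : MForm I M F 0) {x₁ x₂ : M} (h : x₁ = x₂)
    (w₁ : Fin 0 → TangentSpace I x₁) (w₂ : Fin 0 → TangentSpace I x₂) : α x₁ w₁ = α x₂ w₂ := by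
  subst h
  rw [Subsingleton.elim w₁ w₂]

omit [FiniteDimensional ℝ E] [CompleteSpace F] in
/-- **Closed `0`-forms on a chart-convex set are constant**: a `0`-cocycle of
`Ω•(chartSet I p C)` takes the same value (on the empty tuple) at all points of the set
(Lee (2013), Prop. 17.6). [cite: LeeSmoothManifolds2013, Prop. 17.6] -/
theorem localDeRhamComplex.apply_eq_of_d_eq_zero_chartSet (p : M) {C : Set E} (hC : IsOpen C)
    (hCc : Convex ℝ C) (hCT : C ⊆ (extChartAt I p).target)
    {z : smoothFormsOn I F (chartSet I p C) 0}
    (hz : (localDeRhamComplex I F (isOpen_chartSet I p hC)).d 0 1 z = 0) {x y : M}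
    (hx : x ∈ chartSet I p C) (hy : y ∈ chartSet I p C) :
    (z : MForm I M F 0) x Fin.elim0 = (z : MForm I M F 0) y Fin.elim0 := by
  rw [localDeRhamComplex_d_eq_zero_iff] at hz
  have key := inChart_apply_eq_of_mem_localClosedForms_zero p hC hCc hCT hz hy.2 hx.2
  -- read the representative at the two chart points
  have hx' : (extChartAt I p).symm (extChartAt I p x) = x := (extChartAt I p).left_inv hx.1
  have hy' : (extChartAt I p).symm (extChartAt I p y) = y := (extChartAt I p).left_inv hy.1
  have ex := congrArg (fun φ : E [⋀^Fin 0]→L[ℝ] F ↦ φ Fin.elim0) key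
  simp only [MForm.inChart_apply] at ex
  rw [MForm.apply_zero_eq_of_eq (z : MForm I M F 0) hx'.symm Fin.elim0 _,
    MForm.apply_zero_eq_of_eq (z : MForm I M F 0) hy'.symm Fin.elim0 _]
  exact ex

end Poincare

end Literature.Geometry.Kaehler
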